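import Mathlib
import Literature.Analysis.FluidPDE.SuitableWeak
import Literature.Analysis.FluidPDE.LocalTypeI
import Literature.Analysis.FluidPDE.CKNInterpolationEstimate
import HarnessLib

/-!
# The CUBIC gauge of the power-gauged ancient Euler class (crux `EulerZoomLiouville.PowerGaugeEulerLiouville`)

Route `EulerZoomLiouville` (NavierStokesRegularity), crux E = stmt-NavierStokesRegularity-19832
`PowerGaugeEulerLiouville`: Seregin's power-gauged class asks `a^{2ρ} A(a) + a^{ρ} E(a) + a^{2ρ} D(a) ≤ c`
at the origin for all `a > 0` (tree `cknA`, `cknE`, `cknD`).  The flux lever of the open core stub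
(`stub_noCollapseFromZero`; see the lead's `…Flux.lean`: a nontrivial member imports an infinite cubic/pressure
flux from infinity) needs the CUBIC quantity `C(a) = a⁻² ∫∫_{Q_a} |u|³` (tree `cknC`), which the crux does
not list.  It comes for free from the CKN interpolation inequality of the tree
(`exists_cknC_le_rpow`: `C(r) ≤ C₀ (A_ess(r) + E(r))^{3/2}`, Robinson–Rodrigo–Sadowski Lemma 15.10 /
CKN 1982 Lemma 5.1):

* `cknC_le_of_gauge` — for a member, `C(a) ≤ C₀ (c a^{−2ρ} + c a^{−ρ})^{3/2}` for every `a > 0`;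
* `cknC_le_of_gauge_of_one_le` — hence `C(a) ≤ C₀ (2c)^{3/2} a^{−3ρ/2}` for `a ≥ 1` (`ρ ≥ 0`), i.e.
  `∫∫_{Q_a} |u|³ ≤ C₀ (2c)^{3/2} a^{2 − 3ρ/2}` — the fourth gauge of Seregin's class (3.5)–(3.8).

WHAT THIS IS NOT: not NS; bookkeeping that every flux-control attempt on the open core starts from. [folklore]
-/

noncomputable section

set_option linter.dupNamespace false

open MeasureTheory Set Filter Topology Metric Function TopologicalSpace
open scoped ENNReal NNReal

namespace Summit.NavierStokesRegularity.NavierStokesRegularity.Theorems.PowerGaugeEulerLiouville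

open Literature.Analysis Literature.Analysis.FunctionSpaces Literature.Analysis.FluidPDE

/-- **The cubic gauge from the `A`- and `E`-gauges.**  For `u` with weak spatial gradient `H` on the slab
`(−∞,0) × ℝ³` obeying `a^{2ρ} A(a) ≤ c` and `a^{ρ} E(a) ≤ c` at the origin (`a > 0`):
`C(a) ≤ C₀ · (c a^{−2ρ} + c a^{−ρ})^{3/2}`, with the absolute constant `C₀` of the tree's interpolation
inequality `exists_cknC_le_rpow`. [folklore] -/
theorem cknC_le_of_gauge :
    ∃ C₀ : ℝ≥0, ∀ (ρ : ℝ) (u : ℝ → EuclideanSpace ℝ (Fin 3) → EuclideanSpace ℝ (Fin 3))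
      (H : ℝ → EuclideanSpace ℝ (Fin 3) → EuclideanSpace ℝ (Fin 3) →L[ℝ] EuclideanSpace ℝ (Fin 3)) (c : ℝ≥0),
      HasWeakSpatialGradientOn (slab (EuclideanSpace ℝ (Fin 3)) (Iio 0) isOpen_Iio) u H →
      (∀ a : ℝ, 0 < a → ENNReal.ofReal (a ^ (2 * ρ)) * cknA a (0 : ℝ × EuclideanSpace ℝ (Fin 3)) u ≤ (c : ℝ≥0∞)) →
      (∀ a : ℝ, 0 < a → ENNReal.ofReal (a ^ ρ) * cknE a (0 : ℝ × EuclideanSpace ℝ (Fin 3)) H ≤ (c : ℝ≥0∞)) →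
      ∀ a : ℝ, 0 < a →
        cknC a (0 : ℝ × EuclideanSpace ℝ (Fin 3)) u ≤
          C₀ * (ENNReal.ofReal (c * a ^ (-(2 * ρ))) + ENNReal.ofReal (c * a ^ (-ρ))) ^ (3 / 2 : ℝ) := by
  obtain ⟨C₀, hC₀⟩ := exists_cknC_le_rpow
  refine ⟨C₀, fun ρ u H c hH hA hE a ha => ?_⟩
  -- the weak gradient on the parabolic cylinder `Q_a(0,0) ⊆ slab`
  have hQ : parabolicCylinderOpens a (0 : ℝ × EuclideanSpace ℝ (Fin 3)) ≤
      slab (EuclideanSpace ℝ (Fin 3)) (Iio 0) isOpen_Iio := by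
    intro z hz
    rw [mem_slab]
    have := (mem_parabolicCylinder.1 hz).1.2
    simpa using this
  have hH' := hH.mono hQ
  -- unscaled bounds: `A(a) ≤ c a^{-2ρ}`, `E(a) ≤ c a^{-ρ}`
  have hdiv : ∀ (γ : ℝ) (X : ℝ≥0∞), ENNReal.ofReal (a ^ γ) * X ≤ (c : ℝ≥0∞) →
      X ≤ ENNReal.ofReal (c * a ^ (-γ)) := by
    intro γ X hX
    have hpos : 0 < a ^ γ := Real.rpow_pos_of_pos ha γ
    have h1 : X ≤ (c : ℝ≥0∞) / ENNReal.ofReal (a ^ γ) := by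
      rw [ENNReal.le_div_iff_mul_le (Or.inl ((ENNReal.ofReal_pos.2 hpos).ne')) (Or.inl ENNReal.ofReal_ne_top),
        mul_comm]
      exact hX
    refine h1.trans (le_of_eq ?_)
    rw [ENNReal.coe_nnreal_eq, ← ENNReal.ofReal_div_of_pos hpos, Real.rpow_neg ha.le, div_eq_mul_inv]
  have hA' : cknAEss a (0 : ℝ × EuclideanSpace ℝ (Fin 3)) u ≤ ENNReal.ofReal (c * a ^ (-(2 * ρ))) :=
    cknAEss_le_cknA.trans (hdiv _ _ (hA a ha))
  have hE' : cknE a (0 : ℝ × EuclideanSpace ℝ (Fin 3)) H ≤ ENNReal.ofReal (c * a ^ (-ρ)) := hdiv _ _ (hE a ha)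
  have hAfin : cknAEss a (0 : ℝ × EuclideanSpace ℝ (Fin 3)) u ≠ ∞ := ne_top_of_le_ne_top ENNReal.ofReal_ne_top hA'
  have hEfin : cknE a (0 : ℝ × EuclideanSpace ℝ (Fin 3)) H ≠ ∞ := ne_top_of_le_ne_top ENNReal.ofReal_ne_top hE'
  refine (hC₀ u H 0 a ha hH' hAfin hEfin).trans ?_
  gcongr

/-- **The cubic gauge for `a ≥ 1`**: under the `A`- and `E`-gauges with `ρ ≥ 0`,
`C(a) ≤ C₀ (2c)^{3/2} a^{−3ρ/2}` for `a ≥ 1`; equivalently `∫∫_{Q_a} |u|³ ≤ C₀ (2c)^{3/2} a^{2−3ρ/2}`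
(Seregin's cubic condition in the class (3.5)–(3.8), here DERIVED from `A` and `E`). [folklore] -/
theorem cknC_le_of_gauge_of_one_le :
    ∃ C₀ : ℝ≥0, ∀ (ρ : ℝ), 0 ≤ ρ → ∀ (u : ℝ → EuclideanSpace ℝ (Fin 3) → EuclideanSpace ℝ (Fin 3))
      (H : ℝ → EuclideanSpace ℝ (Fin 3) → EuclideanSpace ℝ (Fin 3) →L[ℝ] EuclideanSpace ℝ (Fin 3)) (c : ℝ≥0),
      HasWeakSpatialGradientOn (slab (EuclideanSpace ℝ (Fin 3)) (Iio 0) isOpen_Iio) u H →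
      (∀ a : ℝ, 0 < a → ENNReal.ofReal (a ^ (2 * ρ)) * cknA a (0 : ℝ × EuclideanSpace ℝ (Fin 3)) u ≤ (c : ℝ≥0∞)) →
      (∀ a : ℝ, 0 < a → ENNReal.ofReal (a ^ ρ) * cknE a (0 : ℝ × EuclideanSpace ℝ (Fin 3)) H ≤ (c : ℝ≥0∞)) →
      ∀ a : ℝ, 1 ≤ a →
        cknC a (0 : ℝ × EuclideanSpace ℝ (Fin 3)) u ≤
          C₀ * ENNReal.ofReal ((2 * c) ^ (3 / 2 : ℝ) * a ^ (-(3 * ρ / 2))) := by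
  obtain ⟨C₀, hC₀⟩ := cknC_le_of_gauge
  refine ⟨C₀, fun ρ hρ u H c hH hA hE a ha => ?_⟩
  have ha0 : 0 < a := lt_of_lt_of_le one_pos ha
  refine (hC₀ ρ u H c hH hA hE a ha0).trans ?_
  gcongr
  -- `(c a^{-2ρ} + c a^{-ρ})^{3/2} ≤ (2c a^{-ρ})^{3/2} = (2c)^{3/2} a^{-3ρ/2}` for `a ≥ 1`, `ρ ≥ 0`
  have h1 : a ^ (-(2 * ρ)) ≤ a ^ (-ρ) := Real.rpow_le_rpow_of_exponent_le ha (by linarith)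
  have h2 : ENNReal.ofReal (c * a ^ (-(2 * ρ))) + ENNReal.ofReal (c * a ^ (-ρ)) ≤
      ENNReal.ofReal (2 * c * a ^ (-ρ)) := by
    rw [← ENNReal.ofReal_add (by positivity) (by positivity)]
    refine ENNReal.ofReal_le_ofReal ?_
    have : (c : ℝ) * a ^ (-(2 * ρ)) ≤ c * a ^ (-ρ) := mul_le_mul_of_nonneg_left h1 c.2
    linarith
  calc (ENNReal.ofReal (c * a ^ (-(2 * ρ))) + ENNReal.ofReal (c * a ^ (-ρ))) ^ (3 / 2 : ℝ)
      ≤ (ENNReal.ofReal (2 * c * a ^ (-ρ))) ^ (3 / 2 : ℝ) := ENNReal.rpow_le_rpow h2 (by norm_num)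
    _ = ENNReal.ofReal ((2 * c) ^ (3 / 2 : ℝ) * a ^ (-(3 * ρ / 2))) := by
        rw [ENNReal.ofReal_rpow_of_nonneg (by positivity) (by norm_num), Real.mul_rpow (by positivity)
          (Real.rpow_nonneg ha0.le _), ← Real.rpow_mul ha0.le]
        congr 2
        ring_nf

end Summit.NavierStokesRegularity.NavierStokesRegularity.Theorems.PowerGaugeEulerLiouville

end
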